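import Summits.BirchSwinnertonDyer.BirchSwinnertonDyer.Theorems.AdditiveKolyvaginRoadInductionOfLevelSystemsDict
import Summits.BirchSwinnertonDyer.BirchSwinnertonDyer.Theorems.KolyvaginRoadThreeZhangTriangulationFinite
import HarnessLib

/-!
# Route `AdditiveKolyvaginRoad`, crux KS′ `LevelKolyvaginSystemsAdditive` (item stmt-BirchSwinnertonDyer-21396):
# VANISHING ORDER ZERO AT TOTAL RANK ONE, ENGINE AND DICTIONARY LAYERS — toward the registered stub
# `stub_kolyvaginRankOneVanishing` of line `additive_fibre_ignition` (cell `pub/bsd-wall`, width seat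
# `bsd-wall-akr-p2x-w2` g3; `--supports stmt-BirchSwinnertonDyer-21396`, helper; part 1 of 2)

WHY THIS FILE. Line `additive_fibre_ignition` of crux KS′ carries the ignition seed (a non-zero Kolyvagin class at
SOME conductor `m₀`) up to a non-empty even level `n₀` of total canonical rank `≤ 1` (`stub_levelClimbOfIgnition`)
and must then see the class on ZERO Kolyvagin primes, `κ₀ ∅ n₀`, non-zero — the seed the landed socket
`levelKolyvaginSystemsAdditive_of_seed_free` consumes. That last step is Kolyvagin's TRIANGULATION, W. Zhang's
Lemma 8.4 (1): at a level whose classes satisfy the Kolyvagin-system axioms, with `ν` the vanishing order (the least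
number of Kolyvagin primes carrying a non-zero class) and `ε = ε₀ · (−1)^ν`, `dim Sel^{ε} = ν + 1`. So total rank
`≤ 1` forces `ν = 0`.

WHAT. The tree already holds Lemma 8.4 (1)+(3) as PURE LINEAR ALGEBRA with every number-theoretic input a named
hypothesis shape and NO finiteness posit (`ZhangTriangulation.triangulation_at_finite`, zhang3-p1), and akr-p1's
instantiation pattern of its inputs for the AKR carrier (`inductionOfLevelSystemsP_of_engineInputs ∕ _of_dictionaries`,
whose `have` blocks are re-run here at ONE level). Two theorems:
* §1 `kappa_empty_ne_zero_of_engineInputs` — over ANY place-indexed apparatus, engine currency: classes `κ m` at one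
  level with signs `ε ^^ bodd #m`, (REC) (Cheb) (Supply) (Perf) (Line) (Iso), the membership dictionary for
  `SelQP … n₀`, total rank `≤ 1`, some `κ m ≠ 0` ⟹ `κ ∅ ≠ 0` (`triangulation_at_finite` with base locus `B := ∅`,
  `Sel = SelRel := SelQP … n₀`, at the vanishing order `ν := Nat.find …`; then `ν + 1 ≤ 1`);
* §2 `kappa_empty_ne_zero_of_dictionaries` — the same over the places of `K`, the classes' rows in the TREE's currency
  (`selmerLocalKer` ∕ `toricLocalKer` ∕ `transverseLocalKerP` ∕ `torsionLocalKer`), modulo per-place dictionaries and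
  the level-system-free inputs (REC), (Iso), (Perf), (Line), (Cheb) ×2, (Supply).
Part 2 (`…RankOneVanishing.lean`) reads the level-system-free inputs off a `KolyvaginLocalPackageP` (from DUAL.2) and
states the registered signature verbatim.

HONEST FRAMING: two theorems; 0 definitions, 0 named facts, 0 `sorry`; CONDITIONAL on every input shape; uniform in
the apparatus. Closes nothing by itself; KS′ is not proved here and BSD is NOT proved by any of this.

References: [cite: WZhang2014, §8.1, Lemma 8.1, Lemma 8.2, Lemma 8.4 (1), pp. 234–239]
[cite: McCallumLMS1991, Prop. 3.1, Lemma 5.3].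
-/

-- single-conjunct summit: `Summit.BirchSwinnertonDyer.BirchSwinnertonDyer.…` repeats the name by design
set_option linter.dupNamespace false
set_option autoImplicit false

noncomputable section

open scoped Classical

namespace Summit.BirchSwinnertonDyer.BirchSwinnertonDyer.Theorems.AdditiveKoly

open WeierstrassCurve NumberField IsDedekindDomain
  Literature.NumberTheory.EllipticCurves Literature.NumberTheory.EllipticCurves.ModularForms
  Literature.NumberTheory.GaloisRepresentations Module
open Summit.BirchSwinnertonDyer.Rank1Residual.X11b.Three.Koly
open Summit.BirchSwinnertonDyer.Rank1Residual.X11b.Three.Koly.Method2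

section Engine

variable (W : WeierstrassCurve ℚ) (K : Type) [Field K] [NumberField K] (p : ℕ)
variable [W.IsElliptic] [W.IsGloballyMinimal] [NeZero (W.conductorNorm ℤ)] [Fact p.Prime]
  (ι : K →+* ℂ) (c : K ≃ₐ[ℚ] K) [Module (ZMod p) (Vp W K p)]

/-! ## §1 Engine currency: vanishing order zero at total rank one -/

omit [W.IsElliptic] [NeZero (W.conductorNorm ℤ)] in
/-- **Vanishing order zero at total rank `≤ 1`, ENGINE CURRENCY** (W. Zhang's Lemma 8.4 (1) read at one level). Over
ANY place-indexed apparatus `(P, Hv, loc, b, E, L, pl, Fv, Tv)`: classes `κ m ∈ H¹(K, E[p])` on the finite sets `m`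
of Kolyvagin primes with signs `ε ^^ bodd #m`, Selmer off `m`, transverse on `m`, the zero-iff-zero relation, the
membership dictionary of the level-`n₀` canonical spaces `SelQP … n₀`, and the level-independent (REC), (Cheb) ×2,
(Supply), (Perf) ∕ (Line) ∕ (Iso), `hpl`, `hLF`. If the total rank `dim Sel⁺ + dim Sel⁻ ≤ 1` and some `κ m ≠ 0`, then
`κ ∅ ≠ 0`: with `ν` the vanishing order, `triangulation_at_finite` (base locus `∅`) gives `dim Sel^{ε_ν} = ν + 1 ≤ 1`.
CONDITIONAL on every input shape. [cite: WZhang2014, Lemma 8.4 (1), pp. 236–238] -/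
theorem kappa_empty_ne_zero_of_engineInputs (n₀ : Finset (AdmQ W K p)) (ε : Bool)
    (κ : Finset {ℓ // Zhang2014.IsKolyvaginPrime (W.conductorNorm ℤ) W K p ℓ} → Vp W K p)
    {P : Type} [DecidableEq P] {Hv : P → Type} [∀ v, AddCommGroup (Hv v)] [∀ v, Module (ZMod p) (Hv v)]
    (E : Bool → Submodule (ZMod p) (Vp W K p)) (loc : (v : P) → Vp W K p →ₗ[ZMod p] Hv v)
    (b : (v : P) → Hv v →ₗ[ZMod p] Hv v →ₗ[ZMod p] ZMod p)
    (L : (v : P) → Submodule (ZMod p) (Hv v))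
    (pl : {ℓ // Zhang2014.IsKolyvaginPrime (W.conductorNorm ℤ) W K p ℓ} → P)
    (Fv Tv : (ℓ : {ℓ // Zhang2014.IsKolyvaginPrime (W.conductorNorm ℤ) W K p ℓ}) → Submodule (ZMod p) (Hv (pl ℓ)))
    (hSel : ∀ (s : Bool) (x : Vp W K p), x ∈ SelQP W K p c n₀ s ↔ x ∈ E s ∧ ∀ v, loc v x ∈ L v)
    (hpl : Function.Injective pl)
    (hLF : ∀ ℓ, L (pl ℓ) = Fv ℓ)
    (hisoL : ∀ (v : P), ∀ x ∈ L v, ∀ y ∈ L v, b v x y = 0)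
    (hisoT : ∀ ℓ, ∀ x ∈ Tv ℓ, ∀ y ∈ Tv ℓ, b (pl ℓ) x y = 0)
    (hperf : ∀ ℓ (s : Bool), ∀ x ∈ E s, ∀ y ∈ E s, loc (pl ℓ) x ∈ Fv ℓ → loc (pl ℓ) x ≠ 0 →
      loc (pl ℓ) y ∈ Tv ℓ → loc (pl ℓ) y ≠ 0 → b (pl ℓ) (loc (pl ℓ) x) (loc (pl ℓ) y) ≠ 0)
    (hline : ∀ ℓ (s : Bool), ∃ e : Hv (pl ℓ), ∀ x ∈ E s, loc (pl ℓ) x ∈ Fv ℓ → ∃ a : ZMod p, loc (pl ℓ) x = a • e)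
    (hrec : ∀ (x y : Vp W K p) (T : Finset P), (∀ v, v ∉ T → b v (loc v x) (loc v y) = 0) →
      ∑ v ∈ T, b v (loc v x) (loc v y) = 0)
    (hcE : ∀ m : Finset {ℓ // Zhang2014.IsKolyvaginPrime (W.conductorNorm ℤ) W K p ℓ},
      κ m ∈ E (ε ^^ Nat.bodd m.card))
    (hcL : ∀ (m : Finset {ℓ // Zhang2014.IsKolyvaginPrime (W.conductorNorm ℤ) W K p ℓ}) (v : P),
      (∀ ℓ ∈ m, pl ℓ ≠ v) → loc v (κ m) ∈ L v)
    (hcT : ∀ (m : Finset {ℓ // Zhang2014.IsKolyvaginPrime (W.conductorNorm ℤ) W K p ℓ}), ∀ ℓ ∈ m,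
      loc (pl ℓ) (κ m) ∈ Tv ℓ)
    (hfs : ∀ (m : Finset {ℓ // Zhang2014.IsKolyvaginPrime (W.conductorNorm ℤ) W K p ℓ}) ℓ, ℓ ∉ m →
      (loc (pl ℓ) (κ (insert ℓ m)) = 0 ↔ loc (pl ℓ) (κ m) = 0))
    (hCheb1 : ∀ x : Vp W K p, x ≠ 0 → ∀ T : Finset {ℓ // Zhang2014.IsKolyvaginPrime (W.conductorNorm ℤ) W K p ℓ},
      ∃ ℓ, ℓ ∉ T ∧ loc (pl ℓ) x ≠ 0)
    (hCheb2 : ∀ (s : Bool), ∀ x ∈ E s, ∀ y ∈ E (!s), x ≠ 0 → y ≠ 0 →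
      ∀ T : Finset {ℓ // Zhang2014.IsKolyvaginPrime (W.conductorNorm ℤ) W K p ℓ},
      ∃ ℓ, ℓ ∉ T ∧ loc (pl ℓ) x ≠ 0 ∧ loc (pl ℓ) y ≠ 0)
    (hSupply : ∀ (ℓ : {ℓ // Zhang2014.IsKolyvaginPrime (W.conductorNorm ℤ) W K p ℓ}) (T : Finset _), ℓ ∉ T →
      ∀ s : Bool, ∃ x ∈ E s, x ≠ 0 ∧
        (∀ v : P, v ≠ pl ℓ → (∀ ℓ' ∈ T, pl ℓ' ≠ v) → loc v x ∈ L v) ∧ ∀ ℓ' ∈ T, loc (pl ℓ') x ∈ Tv ℓ')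
    (hrk : finrank (ZMod p) (SelQP W K p c n₀ true) + finrank (ZMod p) (SelQP W K p c n₀ false) ≤ 1)
    (hne : ∃ m, κ m ≠ 0) : κ ∅ ≠ 0 := by
  -- the vanishing order
  have hex : ∃ k : ℕ, ∃ m : Finset {ℓ // Zhang2014.IsKolyvaginPrime (W.conductorNorm ℤ) W K p ℓ},
      m.card = k ∧ κ m ≠ 0 := by
    obtain ⟨m, hm⟩ := hne
    exact ⟨m.card, m, rfl, hm⟩
  have hν : ∃ m : Finset {ℓ // Zhang2014.IsKolyvaginPrime (W.conductorNorm ℤ) W K p ℓ},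
      m.card = Nat.find hex ∧ κ m ≠ 0 := Nat.find_spec hex
  have hmin : ∀ m : Finset {ℓ // Zhang2014.IsKolyvaginPrime (W.conductorNorm ℤ) W K p ℓ},
      m.card < Nat.find hex → κ m = 0 := by
    intro m hm
    by_contra h
    exact Nat.find_min hex hm ⟨m, rfl, h⟩
  -- Zhang's Lemma 8.4 (1) at the vanishing order, base locus `∅` (so `SelRel = Sel`)
  have hSelRel : ∀ (s : Bool) (x : Vp W K p),
      x ∈ SelQP W K p c n₀ s ↔ x ∈ E s ∧ ∀ v, v ∉ (∅ : Set P) → loc v x ∈ L v := fun s x ↦ by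
    rw [hSel]
    simp only [Set.mem_empty_iff_false, not_false_eq_true, forall_const]
  have hB : ∀ v ∈ (∅ : Set P), ∀ m : Finset {ℓ // Zhang2014.IsKolyvaginPrime (W.conductorNorm ℤ) W K p ℓ},
      loc v (κ m) = 0 := fun v hv ↦ (Set.notMem_empty v hv).elim
  obtain ⟨-, -, hdim, -, -⟩ := ZhangTriangulation.triangulation_at_finite E loc b L pl Fv Tv κ ε (∅ : Set P)
    (SelQP W K p c n₀) (SelQP W K p c n₀) hSel hSelRel hB hpl hLF hisoL hisoT hperf hline hrec hcE hcL hcT hfs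
    hCheb1 hCheb2 hSupply hν hmin
  -- total rank ≤ 1 forces `ν = 0`
  have hle : ∀ s : Bool, finrank (ZMod p) (SelQP W K p c n₀ s) ≤ 1 := by
    intro s
    cases s <;> omega
  have h0 : Nat.find hex = 0 := by
    have := hle (ε ^^ Nat.bodd (Nat.find hex))
    omega
  obtain ⟨m, hm, hm0⟩ := hν
  rw [h0, Finset.card_eq_zero] at hm
  exact hm ▸ hm0

/-! ## §2 Dictionary layer: the classes' rows in the tree's currency -/

omit [W.IsElliptic] [NeZero (W.conductorNorm ℤ)] in
/-- **Vanishing order zero at total rank `≤ 1`, DICTIONARY LAYER.** Apparatus over the places `v : Place K`: local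
spaces `Hv v` with `ZMod p`-linear localisations `loc v` and bilinear forms `b v`; eigenspaces `E s` (dictionary
`hE`); per-place conditions `Kum v` (dictionaries `hKumInf`, `hKumFin`), `Tor v` (`hTor`), `Tr ℓ` at the place
`plK ℓ` of the Kolyvagin prime `ℓ` (`hTr`), strict vanishing (`hZero`); the level-`n₀` structure `L` pinned by
`hLinf` ∕ `hLkum` ∕ `hLtor`. Level-system-free inputs kept as hypotheses: (REC), isotropy, (Perf), (Line), (Cheb) ×2,
(Supply). The classes `κ m` at level `n₀` enter through their rows in the TREE's currency — sign, Selmer off `m` and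
off `n₀`, Selmer at infinity, toric above `n₀`, transverse above `m`, the zero-iff-zero relation (8.1). Conclusion as
in §1. [cite: WZhang2014, §8.1, Lemma 8.4 (1)] [cite: McCallumLMS1991, Prop. 3.1, Lemma 5.3] -/
theorem kappa_empty_ne_zero_of_dictionaries (n₀ : Finset (AdmQ W K p)) (ε : Bool)
    (κ : Finset {ℓ // Zhang2014.IsKolyvaginPrime (W.conductorNorm ℤ) W K p ℓ} → Vp W K p)
    {Hv : Place K → Type} [∀ v, AddCommGroup (Hv v)] [∀ v, Module (ZMod p) (Hv v)]
    (loc : (v : Place K) → Vp W K p →ₗ[ZMod p] Hv v) (b : (v : Place K) → Hv v →ₗ[ZMod p] Hv v →ₗ[ZMod p] ZMod p)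
    (E : Bool → Submodule (ZMod p) (Vp W K p))
    (Kum : (v : Place K) → Submodule (ZMod p) (Hv v))
    (Tor : (v : HeightOneSpectrum (𝓞 K)) → Submodule (ZMod p) (Hv (Sum.inr v)))
    (plK : {ℓ // Zhang2014.IsKolyvaginPrime (W.conductorNorm ℤ) W K p ℓ} → HeightOneSpectrum (𝓞 K))
    (Tr : (ℓ : {ℓ // Zhang2014.IsKolyvaginPrime (W.conductorNorm ℤ) W K p ℓ}) →
      Submodule (ZMod p) (Hv (Sum.inr (plK ℓ))))
    (L : (v : Place K) → Submodule (ZMod p) (Hv v))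
    -- the places of the Kolyvagin primes
    (hplK : ∀ ℓ, ((ℓ : ℕ) : 𝓞 K) ∈ (plK ℓ).asIdeal)
    -- per-place dictionaries with the tree's global currency
    (hE : ∀ (s : Bool) (x : Vp W K p), x ∈ E s ↔ conjAct W c ((p ^ 1 : ℕ) : ℤ) x = sgnP s • x)
    (hKumInf : ∀ (w : InfinitePlace K) (x : Vp W K p),
      x ∈ selmerLocalKer (W.baseChange K) w.Completion ((p ^ 1 : ℕ) : ℤ) ↔ loc (Sum.inl w) x ∈ Kum (Sum.inl w))
    (hKumFin : ∀ (v : HeightOneSpectrum (𝓞 K)) (x : Vp W K p),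
      x ∈ selmerLocalKer (W.baseChange K) (v.adicCompletion K) ((p ^ 1 : ℕ) : ℤ) ↔ loc (Sum.inr v) x ∈ Kum (Sum.inr v))
    (hTor : ∀ (v : HeightOneSpectrum (𝓞 K)) (x : Vp W K p),
      x ∈ toricLocalKer (W.baseChange K) (v.adicCompletion K) ((p ^ 1 : ℕ) : ℤ) ↔ loc (Sum.inr v) x ∈ Tor v)
    (hTr : ∀ (ℓ : {ℓ // Zhang2014.IsKolyvaginPrime (W.conductorNorm ℤ) W K p ℓ}) (x : Vp W K p),
      x ∈ transverseLocalKerP W K p ι ℓ (plK ℓ) ↔ loc (Sum.inr (plK ℓ)) x ∈ Tr ℓ)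
    (hZero : ∀ (v : HeightOneSpectrum (𝓞 K)) (x : Vp W K p),
      x ∈ (W.baseChange K).torsionLocalKer (v.adicCompletion K) ((p ^ 1 : ℕ) : ℤ) ↔ loc (Sum.inr v) x = 0)
    -- the level structure at `n₀`
    (hLinf : ∀ (w : InfinitePlace K), L (Sum.inl w) = Kum (Sum.inl w))
    (hLkum : ∀ (v : HeightOneSpectrum (𝓞 K)), (∀ q ∈ n₀, ((q : ℕ) : 𝓞 K) ∉ v.asIdeal) → L (Sum.inr v) = Kum (Sum.inr v))
    (hLtor : ∀ (v : HeightOneSpectrum (𝓞 K)), ∀ q ∈ n₀, ((q : ℕ) : 𝓞 K) ∈ v.asIdeal → L (Sum.inr v) = Tor v)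
    -- level-system-free local–global inputs
    (hisoL : ∀ (v : Place K), ∀ x ∈ L v, ∀ y ∈ L v, b v x y = 0)
    (hisoT : ∀ (ℓ : {ℓ // Zhang2014.IsKolyvaginPrime (W.conductorNorm ℤ) W K p ℓ}), ∀ x ∈ Tr ℓ, ∀ y ∈ Tr ℓ,
      b (Sum.inr (plK ℓ)) x y = 0)
    (hperf : ∀ (ℓ : {ℓ // Zhang2014.IsKolyvaginPrime (W.conductorNorm ℤ) W K p ℓ}) (s : Bool), ∀ x ∈ E s, ∀ y ∈ E s,
      loc (Sum.inr (plK ℓ)) x ∈ Kum (Sum.inr (plK ℓ)) →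
      loc (Sum.inr (plK ℓ)) x ≠ 0 → loc (Sum.inr (plK ℓ)) y ∈ Tr ℓ → loc (Sum.inr (plK ℓ)) y ≠ 0 →
      b (Sum.inr (plK ℓ)) (loc (Sum.inr (plK ℓ)) x) (loc (Sum.inr (plK ℓ)) y) ≠ 0)
    (hline : ∀ (ℓ : {ℓ // Zhang2014.IsKolyvaginPrime (W.conductorNorm ℤ) W K p ℓ}) (s : Bool),
      ∃ e : Hv (Sum.inr (plK ℓ)), ∀ x ∈ E s,
      loc (Sum.inr (plK ℓ)) x ∈ Kum (Sum.inr (plK ℓ)) → ∃ a : ZMod p, loc (Sum.inr (plK ℓ)) x = a • e)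
    (hrec : ∀ (x y : Vp W K p) (T : Finset (Place K)), (∀ v, v ∉ T → b v (loc v x) (loc v y) = 0) →
      ∑ v ∈ T, b v (loc v x) (loc v y) = 0)
    (hCheb1 : ∀ x : Vp W K p, x ≠ 0 → ∀ T : Finset {ℓ // Zhang2014.IsKolyvaginPrime (W.conductorNorm ℤ) W K p ℓ},
      ∃ ℓ, ℓ ∉ T ∧ loc (Sum.inr (plK ℓ)) x ≠ 0)
    (hCheb2 : ∀ (s : Bool), ∀ x ∈ E s, ∀ y ∈ E (!s), x ≠ 0 → y ≠ 0 →
      ∀ T : Finset {ℓ // Zhang2014.IsKolyvaginPrime (W.conductorNorm ℤ) W K p ℓ},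
      ∃ ℓ, ℓ ∉ T ∧ loc (Sum.inr (plK ℓ)) x ≠ 0 ∧ loc (Sum.inr (plK ℓ)) y ≠ 0)
    (hSupply : ∀ (ℓ : {ℓ // Zhang2014.IsKolyvaginPrime (W.conductorNorm ℤ) W K p ℓ}) (T : Finset _), ℓ ∉ T →
      ∀ s : Bool, ∃ x ∈ E s, x ≠ 0 ∧
        (∀ v : Place K, v ≠ Sum.inr (plK ℓ) → (∀ ℓ' ∈ T, Sum.inr (plK ℓ') ≠ v) → loc v x ∈ L v) ∧
        ∀ ℓ' ∈ T, loc (Sum.inr (plK ℓ')) x ∈ Tr ℓ')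
    -- the rows of the classes at level `n₀`, tree currency
    (hsign : ∀ m : Finset {ℓ // Zhang2014.IsKolyvaginPrime (W.conductorNorm ℤ) W K p ℓ},
      conjAct W c ((p ^ 1 : ℕ) : ℤ) (κ m) = sgnP (ε ^^ Nat.bodd m.card) • κ m)
    (hoff : ∀ (m : Finset {ℓ // Zhang2014.IsKolyvaginPrime (W.conductorNorm ℤ) W K p ℓ}) (v : HeightOneSpectrum (𝓞 K)),
      (∀ ℓ ∈ m, ((ℓ : ℕ) : 𝓞 K) ∉ v.asIdeal) → (∀ q ∈ n₀, ((q : ℕ) : 𝓞 K) ∉ v.asIdeal) →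
      κ m ∈ selmerLocalKer (W.baseChange K) (v.adicCompletion K) ((p ^ 1 : ℕ) : ℤ))
    (hinf : ∀ (m : Finset {ℓ // Zhang2014.IsKolyvaginPrime (W.conductorNorm ℤ) W K p ℓ}) (w : InfinitePlace K),
      κ m ∈ selmerLocalKer (W.baseChange K) w.Completion ((p ^ 1 : ℕ) : ℤ))
    (htor : ∀ m : Finset {ℓ // Zhang2014.IsKolyvaginPrime (W.conductorNorm ℤ) W K p ℓ}, ∀ q ∈ n₀,
      ∀ v : HeightOneSpectrum (𝓞 K), ((q : ℕ) : 𝓞 K) ∈ v.asIdeal →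
      κ m ∈ toricLocalKer (W.baseChange K) (v.adicCompletion K) ((p ^ 1 : ℕ) : ℤ))
    (htr : ∀ m : Finset {ℓ // Zhang2014.IsKolyvaginPrime (W.conductorNorm ℤ) W K p ℓ}, ∀ ℓ ∈ m,
      ∀ v : HeightOneSpectrum (𝓞 K), ((ℓ : ℕ) : 𝓞 K) ∈ v.asIdeal → κ m ∈ transverseLocalKerP W K p ι ℓ v)
    (hrel : ∀ (m : Finset {ℓ // Zhang2014.IsKolyvaginPrime (W.conductorNorm ℤ) W K p ℓ})
      (ℓ : {ℓ // Zhang2014.IsKolyvaginPrime (W.conductorNorm ℤ) W K p ℓ}), ℓ ∉ m →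
      ∀ v : HeightOneSpectrum (𝓞 K), ((ℓ : ℕ) : 𝓞 K) ∈ v.asIdeal →
      (κ (insert ℓ m) ∈ (W.baseChange K).torsionLocalKer (v.adicCompletion K) ((p ^ 1 : ℕ) : ℤ) ↔
        κ m ∈ (W.baseChange K).torsionLocalKer (v.adicCompletion K) ((p ^ 1 : ℕ) : ℤ)))
    (hrk : finrank (ZMod p) (SelQP W K p c n₀ true) + finrank (ZMod p) (SelQP W K p c n₀ false) ≤ 1)
    (hne : ∃ m, κ m ≠ 0) : κ ∅ ≠ 0 := by
  -- uniqueness of the place above an inert Kolyvagin prime (a non-zero prime of a Dedekind domain is maximal)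
  have huniq : ∀ {q : ℕ}, (Ideal.span {(q : 𝓞 K)}).IsPrime → q ≠ 0 → ∀ {v v' : HeightOneSpectrum (𝓞 K)},
      (q : 𝓞 K) ∈ v.asIdeal → (q : 𝓞 K) ∈ v'.asIdeal → v' = v := by
    intro q hq hq0 v v' hv hv'
    have key : ∀ w : HeightOneSpectrum (𝓞 K), (q : 𝓞 K) ∈ w.asIdeal → w.asIdeal = Ideal.span {(q : 𝓞 K)} := by
      intro w hw
      have hle : Ideal.span {(q : 𝓞 K)} ≤ w.asIdeal := by
        rw [Ideal.span_le, Set.singleton_subset_iff]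
        exact hw
      have hne : Ideal.span {(q : 𝓞 K)} ≠ ⊥ := by
        rw [Ne, Ideal.span_singleton_eq_bot]
        exact_mod_cast hq0
      exact ((hq.isMaximal hne).eq_of_le w.isPrime.ne_top hle).symm
    exact HeightOneSpectrum.ext (by rw [key v hv, key v' hv'])
  have hKuniq : ∀ (ℓ : {ℓ // Zhang2014.IsKolyvaginPrime (W.conductorNorm ℤ) W K p ℓ}) (v : HeightOneSpectrum (𝓞 K)),
      ((ℓ : ℕ) : 𝓞 K) ∈ v.asIdeal → v = plK ℓ :=
    fun ℓ v hv ↦ huniq ℓ.2.2.2.2.2.1 ℓ.2.1.ne_zero (hplK ℓ) hv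
  -- membership dictionary for the canonical spaces at level `n₀`
  have hSel : ∀ (s : Bool) (x : Vp W K p), x ∈ SelQP W K p c n₀ s ↔ x ∈ E s ∧ ∀ v, loc v x ∈ L v := by
    intro s x
    rw [mem_selQP_iff, hE]
    refine and_congr_right fun _ ↦ ⟨fun ⟨hinf', hfin, htor'⟩ v ↦ ?_, fun h ↦ ⟨fun w ↦ ?_, fun v hv ↦ ?_,
      fun q hq v hv ↦ ?_⟩⟩
    · rcases v with w | v
      · rw [hLinf]; exact (hKumInf w x).mp (hinf' w)
      · by_cases hv : ∃ q ∈ n₀, ((q : ℕ) : 𝓞 K) ∈ v.asIdeal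
        · obtain ⟨q, hq, hqv⟩ := hv
          rw [hLtor v q hq hqv]; exact (hTor v x).mp (htor' q hq v hqv)
        · push Not at hv
          rw [hLkum v hv]; exact (hKumFin v x).mp (hfin v hv)
    · have := h (Sum.inl w); rw [hLinf] at this; exact (hKumInf w x).mpr this
    · have := h (Sum.inr v); rw [hLkum v hv] at this; exact (hKumFin v x).mpr this
    · have := h (Sum.inr v); rw [hLtor v q hq hv] at this; exact (hTor v x).mpr this
  -- the Kolyvagin places are pairwise distinct and carry the Kummer condition
  have hpl : Function.Injective (fun ℓ ↦ (Sum.inr (plK ℓ) : Place K)) := by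
    intro ℓ ℓ' h
    have h' : plK ℓ = plK ℓ' := Sum.inr_injective h
    by_contra hne
    have hcop : Nat.Coprime (ℓ : ℕ) (ℓ' : ℕ) := (Nat.coprime_primes ℓ.2.1 ℓ'.2.1).mpr (fun h ↦ hne (Subtype.ext h))
    exact not_mem_asIdeal_of_coprime K hcop (plK ℓ) (hplK ℓ) (h' ▸ hplK ℓ')
  have hLF : ∀ ℓ, L (Sum.inr (plK ℓ)) = Kum (Sum.inr (plK ℓ)) := fun ℓ ↦
    hLkum (plK ℓ) fun q _ ↦ not_mem_of_kolyvagin_place_P W K p q ℓ.2 (plK ℓ) (hplK ℓ)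
  -- the Kolyvagin-system readings of the classes
  have hcE : ∀ m : Finset {ℓ // Zhang2014.IsKolyvaginPrime (W.conductorNorm ℤ) W K p ℓ},
      κ m ∈ E (ε ^^ Nat.bodd m.card) := fun m ↦ (hE _ _).mpr (hsign m)
  have hcL : ∀ (m : Finset {ℓ // Zhang2014.IsKolyvaginPrime (W.conductorNorm ℤ) W K p ℓ}) (v : Place K),
      (∀ ℓ ∈ m, (Sum.inr (plK ℓ) : Place K) ≠ v) → loc v (κ m) ∈ L v := by
    intro m v hv
    rcases v with w | v
    · rw [hLinf]; exact (hKumInf w _).mp (hinf m w)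
    · by_cases hvn : ∃ q ∈ n₀, ((q : ℕ) : 𝓞 K) ∈ v.asIdeal
      · obtain ⟨q, hq, hqv⟩ := hvn
        rw [hLtor v q hq hqv]; exact (hTor v _).mp (htor m q hq v hqv)
      · push Not at hvn
        have hvm : ∀ ℓ ∈ m, ((ℓ : ℕ) : 𝓞 K) ∉ v.asIdeal := fun ℓ hℓ hℓv ↦ hv ℓ hℓ (by rw [hKuniq ℓ v hℓv])
        rw [hLkum v hvn]; exact (hKumFin v _).mp (hoff m v hvm hvn)
  have hcT : ∀ (m : Finset {ℓ // Zhang2014.IsKolyvaginPrime (W.conductorNorm ℤ) W K p ℓ}), ∀ ℓ ∈ m,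
      loc (Sum.inr (plK ℓ)) (κ m) ∈ Tr ℓ :=
    fun m ℓ hℓ ↦ (hTr ℓ _).mp (htr m ℓ hℓ (plK ℓ) (hplK ℓ))
  have hfs : ∀ (m : Finset {ℓ // Zhang2014.IsKolyvaginPrime (W.conductorNorm ℤ) W K p ℓ}) ℓ, ℓ ∉ m →
      (loc (Sum.inr (plK ℓ)) (κ (insert ℓ m)) = 0 ↔ loc (Sum.inr (plK ℓ)) (κ m) = 0) := by
    intro m ℓ hℓ
    rw [← hZero, ← hZero]
    exact hrel m ℓ hℓ (plK ℓ) (hplK ℓ)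
  exact kappa_empty_ne_zero_of_engineInputs W K p c n₀ ε κ E loc b L (fun ℓ ↦ Sum.inr (plK ℓ))
    (fun ℓ ↦ Kum (Sum.inr (plK ℓ))) Tr hSel hpl hLF hisoL hisoT hperf hline hrec hcE hcL hcT hfs hCheb1 hCheb2
    hSupply hrk hne

end Engine

end Summit.BirchSwinnertonDyer.BirchSwinnertonDyer.Theorems.AdditiveKoly

end
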